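import Summits.BirchSwinnertonDyer.BirchSwinnertonDyer.Theorems.GenusKolyvaginAtTwoPowDvdShaCardAtTwoRTHeegnerTwinTamagawaValuation
import Summits.BirchSwinnertonDyer.BirchSwinnertonDyer.Theorems.GenusKolyvaginAtTwoGenusPrimitiveSupplyAtTwoHeegnerTwinParity
import Literature.NumberTheory.QuadraticFields.FundamentalDiscriminant
import HarnessLib

/-!
# Route `GenusKolyvaginAtTwo`, LINE 18 `plus_descent` v4.4 on L_T `PowDvdShaCardAtTwoRT` (stmt-BirchSwinnertonDyer-23242):
# stub GP `stub_genusParity` — RECIPROCITY PARITY OF THE GENUS BUDGET: `Δ_W < 0 ⇒ ord₂ C(Wd)` is ODD for the Heegner twin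

Seat `bsd-line-gk2-p1` g14 (LEAD seat 1/3, cell `bsd-f1-sign2`), `--supports stmt-BirchSwinnertonDyer-23242`.
THEOREMS ONLY (no definition, no named fact, no `sorry`); proves the REGISTERED stub `stub_genusParity` of the pen's
skeleton v4.4 (`Cruxes/PowDvdShaCardAtTwoRT/Lines/plus_descent.lean`, skeleton 961638a4b95c) BY NAME AND SIGNATURE.
Nothing here closes an item; BSD is not proved by any of this.

WHAT.  `W/ℚ` globally minimal elliptic with `C(W) = ∏ c_ℓ(W)` odd, `K` imaginary quadratic with ODD `d_K` satisfying the
Heegner hypothesis for `N_W`, `Wd` any (elliptic) model of the twist `W^{(d_K)}`.  Then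
* §1 `neg_one_pow_padicValNat_card_roots_add_one_eq_jacobiSym` — at an odd prime `q ∤ Δ_min(W)`:
  `(−1)^{ord₂(1 + #{roots of ψ mod q})} = (Δ_min(W) / q)` (`ψ = 4x³ + b₂x² + 2b₄x + b₆` the `2`-division cubic of the
  minimal model; `1 + #roots = #Ẽ(𝔽_q)[2] = 2^{i_q}` and `i_q` is EVEN iff `disc ψ = 16Δ` is a square mod `q` — Stickelberger's
  parity for a separable cubic, in the tree as `TwistIstar.exists_card_roots_add_one_eq_two_pow`);
* §2 `jacobiSym_eq_prod_primeFactors` — `J(a | n) = ∏_{p ∣ n} J(a | p)` for square-free `n`;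
  `squarefree_natAbs_discr_of_odd` — an odd quadratic discriminant is square-free;
* §3 **`neg_one_pow_padicValNat_two_tamagawaProduct_twin`: `(−1)^{ord₂ C(Wd)} = sign Δ_min(W)`** — gk2-p3's valuation
  `ord₂ C(Wd) = ord₂ C(W) + Σ_{q ∣ d_K} ord₂(1 + #roots ψ mod q)` (`padicValNat_two_tamagawaProduct_twin_eq`), §1 prime by prime,
  §2, and gk2-p5's reciprocity `J(Δ_min | |d_K|) = sign Δ_min` (`GenusKolyTwin.jacobiSym_minimalDiscriminantInt_natAbs_discr`:
  every prime of `Δ_min` divides `N_W`, hence splits in `K`);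
  hence **`odd_padicValNat_two_tamagawaProduct_twin_of_Δ_neg`** (`Δ_W < 0 ⇒ ord₂ C(Wd)` odd) and
  `even_padicValNat_two_tamagawaProduct_twin_of_Δ_pos` (`Δ_W > 0 ⇒ ord₂ C(Wd)` even; LINE 19 needs no parity bit);
* §4 **`stub_genusParity`** — the registered LINE 18 v4.4 stub, verbatim.

WHY (LINE 18 v4.4).  The pen re-typed THE lever uniformly in the sign of `Δ`: 3a⁗ `stub_twinExhibitionGenus` concludes the RAW
exhibition inequality `2·M₀ ≤ ord₂ g + ord₂ g′ + ord₂ C(Wd)`; the registered v4 text 3a‴ (`… − 1` on `Δ < 0`) is recovered inside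
the skeleton (`twinLadderGenus_of_stubs`) from 3a⁗ + THIS stub + the Cassels–Tate evenness of `ord₂ g`, `ord₂ g′` (gk2-p1 g13
`GenusExact.CasselsTateNumberField.isSquare_natCard_primaryComponent_sha`): `2M₀ ≤ even + even + odd ⇒ 2M₀ ≤ … − 1`.  With this file
GP is a THEOREM; the open stubs of LINE 18 are {3a⁗, P}.

References: [Kramer1981] §2 Prop. 3 (`c_q(E^{(d)}) = #Ẽ(𝔽_q)[2]` at `q ∥ d` good); [IrelandRosen1990] Prop. 5.2.2 (Jacobi reciprocity);
[SilvermanAEC2009] III.1 (`disc ψ₂ = 16Δ`), VIII.8; [SilvermanATAEC1994] IV.9.4 Step 6; [Cox2013] Lemma 1.14.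
-/

set_option autoImplicit false
-- the Theorems namespace of this sub repeats the summit name by design (D-0017 nested layout)
set_option linter.dupNamespace false

noncomputable section

open scoped Classical

namespace Summit.BirchSwinnertonDyer.BirchSwinnertonDyer.Theorems.GenusExact.PlusDescent

open WeierstrassCurve NumberField Literature.NumberTheory.EllipticCurves Polynomial

/-! ## §1 `(−1)^{ord₂(1 + #roots ψ mod q)} = (Δ_min / q)` at a good odd prime `q` -/

section Roots

variable (W : WeierstrassCurve ℚ) [W.IsGloballyMinimal] {q : ℕ} [hq : Fact q.Prime]

/-- **Stickelberger's parity for the `2`-division cubic**: at an odd prime `q ∤ Δ_min(W)`,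
`(−1)^{ord₂(1 + #{x̄ ∈ 𝔽_q : ψ(x̄) = 0})} = (Δ_min(W) / q)`.  The reduction of the integral minimal model is an elliptic curve
over `𝔽_q`, `1 + #roots(ψ̄) = 2ⁱ` with `i` even iff `Δ̄ = disc(ψ̄)/16` is a square (tree `TwistIstar.exists_card_roots_add_one_eq_two_pow`:
`0` or `3` rational roots iff the Frobenius permutation of `E[2] ∖ 0` is even), and `(Δ_min / q) = ±1` according as `Δ̄` is a
square or not. [cite: Kramer1981, §2 proof of Prop. 3 (p. 125)] [cite: SilvermanAEC2009, III.1] -/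
theorem neg_one_pow_padicValNat_card_roots_add_one_eq_jacobiSym (hq2 : q ≠ 2)
    (hqΔ : ¬ (q : ℤ) ∣ minimalDiscriminantInt W) :
    (-1 : ℤ) ^ padicValNat 2
        ({x : ZMod q | 4 * x ^ 3 + ((integralModelInt W).b₂ : ZMod q) * x ^ 2 +
          2 * ((integralModelInt W).b₄ : ZMod q) * x + ((integralModelInt W).b₆ : ZMod q) = 0}.ncard + 1) =
      jacobiSym (minimalDiscriminantInt W) q := by
  have hqP : q.Prime := hq.out
  haveI : NeZero q := ⟨hqP.ne_zero⟩
  have hfact2 : Fact (Nat.Prime 2) := ⟨Nat.prime_two⟩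
  set M := integralModelInt W with hM
  set Mq : WeierstrassCurve (ZMod q) := M.map (Int.castRingHom (ZMod q)) with hMq
  have hΔq : Mq.Δ = (minimalDiscriminantInt W : ZMod q) := by
    rw [hMq, map_Δ, eq_intCast]; rfl
  have hΔq0' : Mq.Δ ≠ 0 := by
    rw [hΔq, Ne, ZMod.intCast_zmod_eq_zero_iff_dvd]
    exact hqΔ
  haveI : Mq.IsElliptic := (WeierstrassCurve.isElliptic_iff _).mpr (Ne.isUnit hΔq0')
  have h2 : (2 : ZMod q) ≠ 0 := by
    have : ((2 : ℕ) : ZMod q) ≠ 0 := by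
      rw [Ne, ZMod.natCast_eq_zero_iff]
      intro h
      exact hq2 ((Nat.prime_dvd_prime_iff_eq hqP Nat.prime_two).mp h)
    exact_mod_cast this
  have h4 : (4 : ZMod q) ≠ 0 := by
    have : (4 : ZMod q) = 2 * 2 := by norm_num
    rw [this]; exact mul_ne_zero h2 h2
  have h16 : (16 : ZMod q) ≠ 0 := by
    have : (16 : ZMod q) = 2 ^ 4 := by norm_num
    rw [this]; exact pow_ne_zero 4 h2
  have ha : Mq.twoTorsionPolynomial.a ≠ 0 := h4
  have hψ0 : Mq.twoTorsionPolynomial.toPoly ≠ 0 := Cubic.ne_zero_of_a_ne_zero ha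
  have hψ : ∀ x : ZMod q, Mq.twoTorsionPolynomial.toPoly.IsRoot x ↔
      4 * x ^ 3 + (M.b₂ : ZMod q) * x ^ 2 + 2 * (M.b₄ : ZMod q) * x + (M.b₆ : ZMod q) = 0 := by
    intro x
    simp only [WeierstrassCurve.twoTorsionPolynomial, Cubic.toPoly, hMq, map_b₂, map_b₄, map_b₆,
      eq_intCast, Polynomial.IsRoot.def, eval_add, eval_mul, eval_C, eval_pow, eval_X]
  have hS : Mq.twoTorsionPolynomial.toPoly.roots.toFinset = Finset.univ.filter fun x : ZMod q =>
      4 * x ^ 3 + (M.b₂ : ZMod q) * x ^ 2 + 2 * (M.b₄ : ZMod q) * x + (M.b₆ : ZMod q) = 0 := by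
    ext x
    rw [Multiset.mem_toFinset, Polynomial.mem_roots hψ0, hψ, Finset.mem_filter]
    simp
  have hdisc : Mq.twoTorsionPolynomial.discr ≠ 0 := by
    rw [WeierstrassCurve.twoTorsionPolynomial_discr]; exact mul_ne_zero h16 hΔq0'
  have hsep : Mq.twoTorsionPolynomial.toPoly.Separable := by
    have hspl : (Mq.twoTorsionPolynomial.toPoly.map (algebraMap (ZMod q) (AlgebraicClosure (ZMod q)))).Splits :=
      IsAlgClosed.splits _
    have hnd : (Cubic.map (algebraMap (ZMod q) (AlgebraicClosure (ZMod q))) Mq.twoTorsionPolynomial).roots.Nodup :=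
      (Cubic.discr_ne_zero_iff_roots_nodup ha hspl).mp hdisc
    rw [Cubic.map_roots] at hnd
    exact (separable_map (algebraMap (ZMod q) (AlgebraicClosure (ZMod q)))).mp
      ((nodup_roots_iff_of_splits (Polynomial.map_ne_zero hψ0) hspl).mp hnd)
  have hcard : (Finset.univ.filter fun x : ZMod q =>
      4 * x ^ 3 + (M.b₂ : ZMod q) * x ^ 2 + 2 * (M.b₄ : ZMod q) * x + (M.b₆ : ZMod q) = 0).card =
        Multiset.card Mq.twoTorsionPolynomial.toPoly.roots := by
    rw [← hS, Multiset.toFinset_card_of_nodup (Polynomial.nodup_roots hsep)]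
  obtain ⟨i, hi, hsq, -⟩ := TwistIstar.exists_card_roots_add_one_eq_two_pow Mq h2
  have hncard : ({x : ZMod q | 4 * x ^ 3 + ((integralModelInt W).b₂ : ZMod q) * x ^ 2 +
      2 * ((integralModelInt W).b₄ : ZMod q) * x + ((integralModelInt W).b₆ : ZMod q) = 0}.ncard + 1) = 2 ^ i := by
    rw [Set.ncard_eq_toFinset_card', Set.toFinset_setOf, ← hM, hcard, hi]
  rw [hncard, padicValNat.prime_pow, ← jacobiSym.legendreSym.to_jacobiSym]
  rcases Nat.even_or_odd i with hev | hod
  · rw [hev.neg_one_pow, eq_comm, legendreSym.eq_one_iff q (by rw [← hΔq]; exact hΔq0'), ← hΔq]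
    exact hsq.mp hev
  · rw [hod.neg_one_pow, eq_comm, legendreSym.eq_neg_one_iff q, ← hΔq]
    exact fun h => (Nat.not_even_iff_odd.mpr hod) (hsq.mpr h)

end Roots

/-! ## §2 Jacobi symbols at square-free moduli; odd quadratic discriminants are square-free -/

/-- For square-free `n`, `J(a | n) = ∏_{p ∣ n} J(a | p)` over the prime factors (multiplicativity in the lower argument;
`n = ∏_{p ∣ n} p`). [folklore] -/
theorem jacobiSym_eq_prod_primeFactors (a : ℤ) {n : ℕ} (hn : Squarefree n) :
    jacobiSym a n = ∏ p ∈ n.primeFactors, jacobiSym a p := by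
  have key : ∀ s : Finset ℕ, (∀ p ∈ s, p ≠ 0) → jacobiSym a (∏ p ∈ s, p) = ∏ p ∈ s, jacobiSym a p := by
    intro s hs
    induction s using Finset.induction_on with
    | empty => simp [jacobiSym.one_right]
    | insert b s hb ih =>
      rw [Finset.prod_insert hb, Finset.prod_insert hb,
        jacobiSym.mul_right' a (hs b (Finset.mem_insert_self b s))
          (Finset.prod_ne_zero_iff.mpr fun p hp ↦ hs p (Finset.mem_insert_of_mem hp)),
        ih fun p hp ↦ hs p (Finset.mem_insert_of_mem hp)]
  conv_lhs => rw [← Nat.prod_primeFactors_of_squarefree hn]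
  exact key _ fun p hp ↦ (Nat.prime_of_mem_primeFactors hp).ne_zero

/-- **An odd quadratic discriminant is square-free** (`d_K ≡ 1 (mod 4)` square-free, the other branch `4 ∣ d_K` of the
fundamental-discriminant dichotomy being excluded by parity). [cite: Cox2013, Lemma 1.14] -/
theorem squarefree_natAbs_discr_of_odd {K : Type*} [Field K] [NumberField K] (h2 : Module.finrank ℚ K = 2)
    (hodd : Odd (NumberField.discr K)) : Squarefree (NumberField.discr K).natAbs := by
  rcases Literature.NumberTheory.QuadraticFields.Quadratic.isFundamentalDiscriminant_discr (K := K) h2 with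
    ⟨-, hsq, -⟩ | ⟨h4, -, -⟩
  · exact Int.squarefree_natAbs.mpr hsq
  · exfalso
    exact (Int.not_even_iff_odd.mpr hodd) (even_iff_two_dvd.mpr ((show (2 : ℤ) ∣ 4 by norm_num).trans h4))

/-! ## §3 `(−1)^{ord₂ C(Wd)} = sign Δ_min(W)` for the Heegner twin; the parity of the genus budget -/

section Twin

variable (W : WeierstrassCurve ℚ) [W.IsElliptic] [W.IsGloballyMinimal]
  {K : Type} [Field K] [NumberField K]

/-- **`(−1)^{ord₂ C(Wd)} = sign Δ_min(W)`** for `W/ℚ` globally minimal elliptic with `C(W)` odd, `K` imaginary quadratic with odd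
`d_K` and the Heegner hypothesis for `N_W`, `Wd = Cd • W^{(d_K)}` any model of the twin: by gk2-p3's valuation
`ord₂ C(Wd) = Σ_{q ∣ d_K} ord₂(1 + #roots ψ mod q)`, the per-prime sign `(−1)^{ord₂(1+#roots)} = (Δ_min / q)` (§1; every `q ∣ d_K` is
odd and of good reduction), `|d_K| = ∏_{q ∣ d_K} q` square-free (§2), and the reciprocity law `J(Δ_min | |d_K|) = sign Δ_min`
(`GenusKolyTwin.jacobiSym_minimalDiscriminantInt_natAbs_discr`). [cite: Kramer1981, §2 Prop. 3] [cite: IrelandRosen1990, Prop. 5.2.2] -/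
theorem neg_one_pow_padicValNat_two_tamagawaProduct_twin (hK : IsImaginaryQuadratic K) (hodd : Odd (NumberField.discr K))
    (hH : SatisfiesHeegnerHypothesis (W.conductorNorm ℤ) K) (hT : Odd W.tamagawaProduct)
    {Wd : WeierstrassCurve ℚ} [Wd.IsElliptic] (Cd : VariableChange ℚ)
    (hWd : Cd • W.quadraticTwist (NumberField.discr K : ℚ) = Wd) :
    (-1 : ℤ) ^ padicValNat 2 Wd.tamagawaProduct = (minimalDiscriminantInt W).sign := by
  have hfact2 : Fact (Nat.Prime 2) := ⟨Nat.prime_two⟩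
  have hW0 : padicValNat 2 W.tamagawaProduct = 0 :=
    padicValNat.eq_zero_of_not_dvd fun h ↦ (Nat.not_even_iff_odd.mpr hT) (even_iff_two_dvd.mpr h)
  rw [padicValNat_two_tamagawaProduct_twin_eq W hK hodd hH Cd hWd, hW0, zero_add, ← Finset.prod_pow_eq_pow_sum,
    ← GenusKolyTwin.jacobiSym_minimalDiscriminantInt_natAbs_discr W hK hodd hH,
    jacobiSym_eq_prod_primeFactors _ (squarefree_natAbs_discr_of_odd hK.1 hodd)]
  refine Finset.prod_congr rfl fun q hq ↦ ?_
  obtain ⟨hqP, hqdvd, -⟩ := Nat.mem_primeFactors.mp hq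
  have hqd : (q : ℤ) ∣ NumberField.discr K := Int.natCast_dvd.mpr hqdvd
  haveI := Fact.mk hqP
  have hq2 : q ≠ 2 := by
    rintro rfl
    exact (Int.not_even_iff_odd.mpr hodd) (even_iff_two_dvd.mpr (by exact_mod_cast hqd))
  have hqΔ : ¬ (q : ℤ) ∣ minimalDiscriminantInt W :=
    not_dvd_minimalDiscriminantInt_of_dvd_discr_of_heegner W K hK.1 hH hqP hq2 hqd
  exact neg_one_pow_padicValNat_card_roots_add_one_eq_jacobiSym W hq2 hqΔ

/-- **`Δ_W < 0 ⇒ ord₂ C(Wd)` is ODD** (same data): `(−1)^{ord₂ C(Wd)} = sign Δ_min = −1`.  The number of transposition primes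
of `d_K` (primes `q ∣ d_K` with `i_q = dim Ẽ(𝔽_q)[2] = 1`) is odd, the other primes of `d_K` contributing `i_q ∈ {0, 2}`.
[cite: Kramer1981, §2 Prop. 3] [cite: IrelandRosen1990, Prop. 5.2.2] -/
theorem odd_padicValNat_two_tamagawaProduct_twin_of_Δ_neg (hK : IsImaginaryQuadratic K)
    (hodd : Odd (NumberField.discr K)) (hH : SatisfiesHeegnerHypothesis (W.conductorNorm ℤ) K)
    (hT : Odd W.tamagawaProduct) (hΔ : W.Δ < 0) {Wd : WeierstrassCurve ℚ} [Wd.IsElliptic] (Cd : VariableChange ℚ)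
    (hWd : Cd • W.quadraticTwist (NumberField.discr K : ℚ) = Wd) :
    Odd (padicValNat 2 Wd.tamagawaProduct) := by
  have h := neg_one_pow_padicValNat_two_tamagawaProduct_twin W hK hodd hH hT Cd hWd
  rw [(GenusKolyTwin.sign_minimalDiscriminantInt_eq_neg_one_iff W).mpr hΔ] at h
  exact (neg_one_pow_eq_neg_one_iff_odd (by norm_num)).mp h

/-- **`Δ_W > 0 ⇒ ord₂ C(Wd)` is EVEN** (same data): `(−1)^{ord₂ C(Wd)} = sign Δ_min = +1` — the LINE 19 (`Δ > 0`) companion: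
there the genus law carries no parity bit. [cite: Kramer1981, §2 Prop. 3] [cite: IrelandRosen1990, Prop. 5.2.2] -/
theorem even_padicValNat_two_tamagawaProduct_twin_of_Δ_pos (hK : IsImaginaryQuadratic K)
    (hodd : Odd (NumberField.discr K)) (hH : SatisfiesHeegnerHypothesis (W.conductorNorm ℤ) K)
    (hT : Odd W.tamagawaProduct) (hΔ : 0 < W.Δ) {Wd : WeierstrassCurve ℚ} [Wd.IsElliptic] (Cd : VariableChange ℚ)
    (hWd : Cd • W.quadraticTwist (NumberField.discr K : ℚ) = Wd) :
    Even (padicValNat 2 Wd.tamagawaProduct) := by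
  have h := neg_one_pow_padicValNat_two_tamagawaProduct_twin W hK hodd hH hT Cd hWd
  have hs : (minimalDiscriminantInt W).sign = 1 := by
    rw [Int.sign_eq_one_iff_pos, ← @Int.cast_pos ℚ, cast_minimalDiscriminantInt]
    exact hΔ
  rw [hs] at h
  exact (neg_one_pow_eq_one_iff_even (by norm_num)).mp h

end Twin

/-! ## §4 The registered LINE 18 v4.4 stub GP, by name and signature -/

/-- **LINE 18 v4.4 stub GP `stub_genusParity` (registered text VERBATIM; skeleton 961638a4b95c on stmt-BirchSwinnertonDyer-23242)
— reciprocity parity of the genus budget.**  On the Heegner twin frame (`W` globally minimal, `C(W)` odd, `K` imaginary quadratic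
with odd `d_K`, every prime of `N_W` split in `K`, `Wd` a globally minimal model of `E^{(d_K)}`): `Δ < 0 ⇒ ord₂ C(Wd)` is ODD
(`odd_padicValNat_two_tamagawaProduct_twin_of_Δ_neg`; the binders `[NeZero (W.conductorNorm ℤ)]`, `[Wd.IsGloballyMinimal]` are not
used).  BSD-free, Ш-free, `M₀`-free; instrument cross-check: `e = ord₂ C(Wd) + [Δ>0] − 1 ∈ {0, 2}` on 262/262 rows (pen, kit j318164 +
j318378). [cite: Kramer1981, §2 Prop. 3] [cite: IrelandRosen1990, Prop. 5.2.2] [cite: SilvermanATAEC1994, IV.9.4 Step 6] -/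
theorem stub_genusParity :
    ∀ (W : WeierstrassCurve ℚ) [W.IsElliptic] [W.IsGloballyMinimal] [NeZero (W.conductorNorm ℤ)], Odd W.tamagawaProduct → W.Δ < 0 → ∀ (K : Type) [Field K] [NumberField K], Literature.NumberTheory.EllipticCurves.IsImaginaryQuadratic K → Odd (NumberField.discr K) → Literature.NumberTheory.EllipticCurves.SatisfiesHeegnerHypothesis (W.conductorNorm ℤ) K → ∀ (Wd : WeierstrassCurve ℚ) [Wd.IsElliptic] [Wd.IsGloballyMinimal], (∃ C : WeierstrassCurve.VariableChange ℚ, C • W.quadraticTwist (NumberField.discr K : ℚ) = Wd) → Odd (padicValNat 2 Wd.tamagawaProduct) := by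
  intro W _ _ _ hT hΔ K _ _ hK hodd hH Wd _ _ hC
  obtain ⟨Cd, hWd⟩ := hC
  exact odd_padicValNat_two_tamagawaProduct_twin_of_Δ_neg W hK hodd hH hT hΔ Cd hWd

end Summit.BirchSwinnertonDyer.BirchSwinnertonDyer.Theorems.GenusExact.PlusDescent

end
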